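import Summits.Ventures.PercRepro.ProfileGapMonoThresholdNullity

/-!
# PercRepro — THE OPEN CORE OF THE THRESHOLD FAMILY AT EVERY CO-RANK: a rank-`(q−1)` flat has at most
`ν + q − 1` points, and at most `ν + q − 2` on a coloop-free matroid unless it is `E` (p5, gen 29;
`proofs/P5-GM1.md` §39(a); announced INBOX 13743 (the general-`q` bound of §37(a)))

`ρ(E) ≤ ρ(F) + #(E ∖ F)` gives `#F + ρ(E) ≤ #E + (q − 1)` for every rank-`(q−1)` set's closure `F`
(`card_clF_add_rk_le_of_mem_Rq`); at equality every outside point is a coloop (`coloop_of_card_clF_add_rk_eq`), so on a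
coloop-free matroid a flat with `ν + q − 1` points is `E` (`clF_eq_gr_of_card_clF_add_rk_eq`).  With the nullity regime
(`thresholdIneq_of_flat_card_le_nullity`: flats of `≤ ν` points), `(I_t)` at co-rank `q` on a coloop-free matroid of
rank `≥ q` can only fail through a rank-`(q−1)` flat with `ν + 1 … ν + q − 2` points
(`thresholdIneq_of_no_long_flat`).  At `q = 3` this is `ProfileGapMonoThresholdLongLine`, whose long-line case is
closed in `…ThreeAll`.
-/

open scoped Matroid

namespace PercRepro.Cogirth

open Finset ThmH Skew Shadow Profile

variable {α : Type} [DecidableEq α] {N : Matroid α} [N.Finite]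

section FlatBound

variable {q t : ℕ}

/-- **A rank-`(q−1)` flat has at most `ν + q − 1` points**: `#(cl B) + ρ(E) ≤ #E + (q − 1)` for `B ∈ Rq N (q − 1)`. -/
theorem card_clF_add_rk_le_of_mem_Rq {B : Finset α} (hB : B ∈ Rq N (q - 1)) :
    (clF N B).card + rk N (gr N) ≤ (gr N).card + (q - 1) := by
  have hBrk : rk N B = q - 1 := rk_eq_of_eRk_eq_cq (mem_Rq.1 hB).2
  have hclg : clF N B ⊆ gr N := clF_subset_gr B
  have hsplit : gr N = clF N B ∪ (gr N \ clF N B) := (union_sdiff_of_subset hclg).symm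
  have h1 : rk N (gr N) ≤ rk N (clF N B) + rk N (gr N \ clF N B) := by
    calc rk N (gr N) = rk N (clF N B ∪ (gr N \ clF N B)) := by rw [← hsplit]
      _ ≤ _ := rk_union_le _ _
  have h2 : rk N (gr N \ clF N B) ≤ (gr N \ clF N B).card := rk_le_card _
  have h3 : (gr N \ clF N B).card = (gr N).card - (clF N B).card := card_sdiff_of_subset hclg
  have h4 : (clF N B).card ≤ (gr N).card := card_le_card hclg
  rw [rk_clF, hBrk] at h1
  omega

/-- **At equality every outside point is a coloop**: `#(cl B) + ρ(E) = #E + (q − 1)` and `z ∉ cl B` give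
`ρ(E ∖ z) + 1 = ρ(E)`. -/
theorem coloop_of_card_clF_add_rk_eq {B : Finset α} (hB : B ∈ Rq N (q - 1))
    (heq : (clF N B).card + rk N (gr N) = (gr N).card + (q - 1)) {z : α} (hz : z ∈ gr N \ clF N B) :
    rk N ((gr N).erase z) + 1 = rk N (gr N) := by
  have hBrk : rk N B = q - 1 := rk_eq_of_eRk_eq_cq (mem_Rq.1 hB).2
  have hclg : clF N B ⊆ gr N := clF_subset_gr B
  have hsub : (gr N).erase z ⊆ clF N B ∪ ((gr N \ clF N B).erase z) := by
    intro y hy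
    rw [mem_erase] at hy
    by_cases hycl : y ∈ clF N B
    · exact mem_union_left _ hycl
    · exact mem_union_right _ (mem_erase.2 ⟨hy.1, mem_sdiff.2 ⟨hy.2, hycl⟩⟩)
  have h1 : rk N ((gr N).erase z) ≤ rk N (clF N B) + rk N ((gr N \ clF N B).erase z) :=
    (rk_mono' hsub).trans (rk_union_le _ _)
  have h2 : rk N ((gr N \ clF N B).erase z) ≤ ((gr N \ clF N B).erase z).card := rk_le_card _
  have h3 : ((gr N \ clF N B).erase z).card = (gr N \ clF N B).card - 1 := card_erase_of_mem hz
  have h4 : (gr N \ clF N B).card = (gr N).card - (clF N B).card := card_sdiff_of_subset hclg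
  have h5 : (clF N B).card ≤ (gr N).card := card_le_card hclg
  have h6 : 0 < (gr N \ clF N B).card := card_pos.2 ⟨z, hz⟩
  have h7 : rk N (gr N) ≤ rk N ((gr N).erase z) + 1 :=
    rk_le_rk_erase_add_one (Subset.refl _) (mem_sdiff.1 hz).1
  rw [rk_clF, hBrk] at h1
  omega

/-- **Coloop-free: a rank-`(q−1)` flat with `ν + q − 1` points is the whole ground set.** -/
theorem clF_eq_gr_of_card_clF_add_rk_eq (hcf : ∀ z ∈ gr N, rk N ((gr N).erase z) = rk N (gr N))
    {B : Finset α} (hB : B ∈ Rq N (q - 1))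
    (heq : (clF N B).card + rk N (gr N) = (gr N).card + (q - 1)) : clF N B = gr N := by
  apply Subset.antisymm (clF_subset_gr B)
  intro z hz
  by_contra hzcl
  have h := coloop_of_card_clF_add_rk_eq hB heq (mem_sdiff.2 ⟨hz, hzcl⟩)
  rw [hcf z hz] at h
  omega

/-- **THE OPEN CORE AT CO-RANK `q`**: on a coloop-free matroid of rank `≥ q` (`2 ≤ q`) with no rank-`(q−1)` flat of
`ν + 1 … ν + q − 2` points, `(I_t)` holds at every offset. -/
theorem thresholdIneq_of_no_long_flat (hq : 2 ≤ q) (hcf : ∀ z ∈ gr N, rk N ((gr N).erase z) = rk N (gr N))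
    (hR : q ≤ rk N (gr N))
    (hlong : ∀ B ∈ Rq N (q - 1), (clF N B).card + rk N (gr N) ≤ (gr N).card ∨
      (gr N).card + (q - 1) ≤ (clF N B).card + rk N (gr N)) :
    ThresholdIneq N q t := by
  apply thresholdIneq_of_flat_card_le_nullity (by omega)
  intro B hB
  rcases hlong B hB with h | h
  · exact h
  · have hle := card_clF_add_rk_le_of_mem_Rq hB
    have heq : (clF N B).card + rk N (gr N) = (gr N).card + (q - 1) := le_antisymm hle h
    have hF := clF_eq_gr_of_card_clF_add_rk_eq hcf hB heq
    have hBrk : rk N B = q - 1 := rk_eq_of_eRk_eq_cq (mem_Rq.1 hB).2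
    have := rk_clF (M := N) B
    rw [hF, hBrk] at this
    omega

end FlatBound

end PercRepro.Cogirth
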